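import Summits.HodgeConjecture.HodgeConjecture.Theorems.MarkmanPartnerTransportPicardThreeK3SquaresZeta9Type
import HarnessLib

/-!
# Route MarkmanPartnerTransport · crux `PicardThreeK3Squares` (stmt-HodgeConjecture-19652) —
# the algebra of the ζ₉ model endomorphism: `θ(θ³ - 3θ + 1) = 0` and `ker θ = ker(g³ - 1)` (rank 10)

Cell hodge-nonav, crux #4, INDEX row M-θ₉ (prover seat hodge-nonav-19652-p1 gen 12; `--supports
stmt-HodgeConjecture-19652`, helper). Fact-free structure theorems for EVERY ζ₉ datum `(g, y₀, θ)` of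
`…PicardThreeK3SquaresZeta9Type` (an integral `k3Form`-isometry `g` of the K3 lattice with `g⁹ = 1`,
cube-fixed part of rank `10`, a period point in the `e^{2πi/9}`-eigenspace, and the model endomorphism
`θ_ℂ = ⅓(2g + 2g⁸ - g² - g⁴ - g⁵ - g⁷)`), certifying in the kernel what the docstring of the named fact
`VanGeemenSchuett2025_zeta9_cycleOnOpenPeriodSet` asserts about the model:

* `thetaC_eq_smul_aeval_of_zeta9Model` — `θ_ℂ = ⅓ · p₃(g)` with the INTEGER polynomial
  `p₃ = 2X + 2X⁸ - X² - X⁴ - X⁵ - X⁷`.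
* `aeval_mul_X_pow_nine_sub_one` — `(X⁹ - 1) · R` is killed by evaluation at `g` (`g⁹ = 1`).
* **`thetaC_quartic_of_zeta9Model`** — `θ_ℂ⁴ - 3θ_ℂ² + θ_ℂ = 0`, i.e. `θ(θ³ - 3θ + 1) = 0`: the minimal
  polynomial of the model endomorphism divides `X(X³ - 3X + 1)`, so its non-zero eigenvalues are the three
  real roots `2cos(2π/9), 2cos(4π/9), 2cos(8π/9)` of `X³ - 3X + 1` — the real-multiplication field of the
  type is the cubic field `ℚ(ζ₉ + ζ₉⁻¹)`, the field of `VanGeemenSchuett2025_rmK3_cycleInduced_zeta9`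
  (`IsCycleInducedRMK3 S 10 (X³ - 3X + 1)`). Mechanism: with `c = g + g⁻¹` one has
  `c³ - 3c + 1 = g³ + g⁻³ + 1 = g⁻³Φ₉(g)`, which vanishes on the primitive part; in the kernel this is the
  integer polynomial identity `p₃⁴ - 27p₃² + 27p₃ = (X⁹ - 1)·R₁` checked by `ring`.
* **`ker_thetaC_eq_of_zeta9Model`** — `ker θ_ℂ = ker(g³ - 1)`: the model endomorphism kills EXACTLY the
  cube-fixed part (`= η₀ NS(X₀)_ℂ` for the CM member); `⊇` from `p₃ = (X³ - 1)(2X⁵ - X⁴ + X² - 2X)`, `⊆`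
  from `27p₃ - p₃³ ≡ -9(X⁶ + X³ - 2)` and `9(X³ - 1) ≡ (X⁶ - 2X³ + 4)(X⁶ + X³ - 2)` `(mod X⁹ - 1)`.
* **`finrank_ker_thetaC_of_zeta9Model`** — hence `dim ker θ_ℂ = 10`: a K3 surface `S` whose admissible
  endomorphism `t` (killing `N¹(S)`) is conjugate to `θ_ℂ` has `ρ(S) ≤ dim ker t = 10`, with equality as
  soon as `t` is injective on `T(S)` (Zarhin: `End_Hdg T(S)_ℚ` is a field) — the type lives at Picard
  number `10`, INSIDE the open Picard list of crux `PicardThreeK3Squares`.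

No definition, no sorry, no named fact.

References: van Geemen–Schütt, Forum Math. Sigma 13 (2025) e2, §2.4–2.6, Thm. 1.1 (9), §5.6;
Artebani–Comparin–Valdés, Comm. Algebra 48 (2020), §1 and Ex. 3.5.
-/

set_option linter.dupNamespace false

noncomputable section

namespace Summit.HodgeConjecture.HodgeConjecture.Theorems.MarkmanPartnerTransport.RMTypeOrbit

open Polynomial
open Literature.AlgebraicGeometry Literature.AlgebraicGeometry.Motives Literature.AlgebraicGeometry.HodgeTheory
open Literature.AlgebraicGeometry.Surfaces

/-- `Zeta9Model[g, y₀, θ]`: VERBATIM the datum conjuncts of the named fact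
`VanGeemenSchuett2025_zeta9_cycleOnOpenPeriodSet` (as in `…Zeta9Type`). Local notation only. -/
local notation3 (prettyPrint := false) "Zeta9Model[" g ", " y₀ ", " θ "]" =>
  ((∀ a b : K3Index → ℂ, k3Form (g a) (g b) = k3Form a b) ∧
    (∀ v : K3Index → ℤ, ∃ w : K3Index → ℤ,
      g (fun i => ((v i : ℤ) : ℂ)) = fun i => ((w i : ℤ) : ℂ)) ∧
    g ^ 9 = 1 ∧
    Module.finrank ℂ (LinearMap.ker (g ^ 3 - 1)) = 10 ∧
    k3Form y₀ y₀ = 0 ∧ 0 < (k3Form (star y₀) y₀).re ∧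
    g y₀ = Complex.exp (2 * Real.pi * Complex.I / 9) • y₀ ∧
    (∀ y : K3Index → ℂ, thetaC θ y =
      (1 / 3 : ℂ) • ((2 : ℂ) • g y + (2 : ℂ) • (g ^ 8) y - (g ^ 2) y - (g ^ 4) y - (g ^ 5) y
        - (g ^ 7) y)))

/-- The integer polynomial `p₃ = 2X + 2X⁸ - X² - X⁴ - X⁵ - X⁷` with `θ_ℂ = ⅓ p₃(g)`. Local notation only. -/
local notation3 (prettyPrint := false) "p₃" =>
  (C (2 : ℂ) * X + C (2 : ℂ) * X ^ 8 - X ^ 2 - X ^ 4 - X ^ 5 - X ^ 7 : ℂ[X])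

variable {g : Module.End ℂ (K3Index → ℂ)} {y₀ : K3Index → ℂ} {θ : Matrix K3Index K3Index ℚ}

/-- **`θ_ℂ = ⅓ · p₃(g)`** for a ζ₉ datum, `p₃ = 2X + 2X⁸ - X² - X⁴ - X⁵ - X⁷`.
[cite: GeemenSchutt2023, §2.4 and §5.6] -/
theorem thetaC_eq_smul_aeval_of_zeta9Model (hZ : Zeta9Model[g, y₀, θ]) :
    thetaC θ = (1 / 3 : ℂ) • Polynomial.aeval g p₃ := by
  obtain ⟨-, -, -, -, -, -, -, hθ⟩ := hZ
  refine LinearMap.ext fun y => ?_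
  rw [hθ y, LinearMap.smul_apply]
  simp only [map_sub, map_add, map_mul, map_pow, Polynomial.aeval_C, Polynomial.aeval_X,
    LinearMap.sub_apply, LinearMap.add_apply, Module.End.mul_apply, Module.algebraMap_end_apply]

/-- Evaluation at `g` kills every multiple of `X⁹ - 1` when `g⁹ = 1`. [folklore] -/
theorem aeval_mul_X_pow_nine_sub_one (hg9 : g ^ 9 = 1) (R : ℂ[X]) :
    Polynomial.aeval g ((X ^ 9 - 1) * R) = 0 := by
  rw [map_mul, map_sub, map_pow, Polynomial.aeval_X, map_one, hg9, sub_self, zero_mul]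

/-- The integer polynomial identity behind `θ(θ³ - 3θ + 1) = 0`:
`p₃⁴ - 27p₃² + 27p₃ = (X⁹ - 1)·R₁` (`c³ - 3c + 1 = g³ + g⁻³ + 1` for `c = g + g⁻¹`). [folklore] -/
theorem pThree_quartic_eq :
    (p₃) ^ 4 - C (27 : ℂ) * (p₃) ^ 2 + C (27 : ℂ) * p₃ =
      (X ^ 9 - 1) * (C (16 : ℂ) * X ^ 23 - C (32 : ℂ) * X ^ 22 + C (24 : ℂ) * X ^ 21
        - C (40 : ℂ) * X ^ 20 + C (17 : ℂ) * X ^ 19 + C (24 : ℂ) * X ^ 18 - C (28 : ℂ) * X ^ 17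
        + C (140 : ℂ) * X ^ 16 - C (138 : ℂ) * X ^ 15 + C (96 : ℂ) * X ^ 14 - C (150 : ℂ) * X ^ 13
        - C (24 : ℂ) * X ^ 12 + C (49 : ℂ) * X ^ 11 - C (107 : ℂ) * X ^ 10 + C (300 : ℂ) * X ^ 9
        - C (152 : ℂ) * X ^ 8 + C (121 : ℂ) * X ^ 7 - C (78 : ℂ) * X ^ 6 - C (49 : ℂ) * X ^ 5
        + C (38 : ℂ) * X ^ 4 - C (108 : ℂ) * X ^ 3 + C (135 : ℂ) * X ^ 2 - C (54 : ℂ) * X) := by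
  simp only [map_ofNat]
  ring

/-- **`θ_ℂ⁴ - 3θ_ℂ² + θ_ℂ = 0` for every ζ₉ datum**: the model endomorphism satisfies
`θ(θ³ - 3θ + 1) = 0`, so its minimal polynomial divides `X(X³ - 3X + 1)` and its non-zero eigenvalues
are roots of `X³ - 3X + 1`, the polynomial of `VanGeemenSchuett2025_rmK3_cycleInduced_zeta9` — the type's
real-multiplication field is the cubic `ℚ(ζ₉ + ζ₉⁻¹)`. Proof: `θ_ℂ = ⅓p₃(g)` and
`p₃⁴ - 27p₃² + 27p₃ ∈ (X⁹ - 1)`. Fact-free. [cite: GeemenSchutt2023, Thm. 1.1 (9), §2.4 and §5.6] -/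
theorem thetaC_quartic_of_zeta9Model (hZ : Zeta9Model[g, y₀, θ]) :
    thetaC θ ^ 4 - (3 : ℂ) • thetaC θ ^ 2 + thetaC θ = 0 := by
  have hg9 : g ^ 9 = 1 := hZ.2.2.1
  have hθ := thetaC_eq_smul_aeval_of_zeta9Model hZ
  set A : Module.End ℂ (K3Index → ℂ) := Polynomial.aeval g p₃ with hA
  have hA4 : A ^ 4 - (27 : ℂ) • A ^ 2 + (27 : ℂ) • A = 0 := by
    have h := congrArg (Polynomial.aeval g) pThree_quartic_eq
    rw [aeval_mul_X_pow_nine_sub_one hg9, map_add, map_sub, map_mul, map_mul, map_pow, map_pow,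
      Polynomial.aeval_C, ← hA] at h
    simpa only [Algebra.algebraMap_eq_smul_one, smul_mul_assoc, one_mul] using h
  have hcalc : thetaC θ ^ 4 - (3 : ℂ) • thetaC θ ^ 2 + thetaC θ =
      (1 / 81 : ℂ) • (A ^ 4 - (27 : ℂ) • A ^ 2 + (27 : ℂ) • A) := by
    rw [hθ, _root_.smul_pow, _root_.smul_pow]
    module
  rw [hcalc, hA4, smul_zero]

/-- `p₃ = (X³ - 1)(2X⁵ - X⁴ + X² - 2X)`: the model endomorphism vanishes on the cube-fixed part.
[folklore] -/
theorem pThree_eq_mul :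
    (p₃) = (C (2 : ℂ) * X ^ 5 - X ^ 4 + X ^ 2 - C (2 : ℂ) * X) * (X ^ 3 - 1) := by
  simp only [map_ofNat]
  ring

/-- `27p₃ - p₃³ + 9(X⁶ + X³ - 2) = (X⁹ - 1)·R₂` (`3θ - θ³ = P_T = -⅓(g³ - 1)(g³ + 2)`, the projector
onto the primitive part). [folklore] -/
theorem pThree_cubic_eq :
    C (27 : ℂ) * p₃ - (p₃) ^ 3 + C (9 : ℂ) * (X ^ 6 + X ^ 3 - C (2 : ℂ)) =
      (X ^ 9 - 1) * (-(C (8 : ℂ) * X ^ 15) + C (12 : ℂ) * X ^ 14 - C (6 : ℂ) * X ^ 13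
        + C (13 : ℂ) * X ^ 12 - C (9 : ℂ) * X ^ 10 + C (9 : ℂ) * X ^ 9 - C (45 : ℂ) * X ^ 8
        + C (27 : ℂ) * X ^ 7 - C (22 : ℂ) * X ^ 6 + C (33 : ℂ) * X ^ 5 + C (15 : ℂ) * X ^ 4 - X ^ 3
        + C (27 : ℂ) * X ^ 2 - C (54 : ℂ) * X + C (18 : ℂ)) := by
  simp only [map_ofNat]
  ring

/-- `9(X³ - 1) - (X⁶ - 2X³ + 4)(X⁶ + X³ - 2) = (X⁹ - 1)(1 - X³)` (`g³ + 2` is invertible modulo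
`g⁹ = 1`). [folklore] -/
theorem nine_mul_X_cube_sub_one_eq :
    C (9 : ℂ) * (X ^ 3 - 1) - (X ^ 6 - C (2 : ℂ) * X ^ 3 + C (4 : ℂ)) * (X ^ 6 + X ^ 3 - C (2 : ℂ)) =
      ((X : ℂ[X]) ^ 9 - 1) * (1 - X ^ 3) := by
  simp only [map_ofNat]
  ring

/-- **`ker θ_ℂ = ker(g³ - 1)` for every ζ₉ datum**: the model endomorphism kills EXACTLY the cube-fixed
part of `g` (for the CM member `X₀` of the D2 family: `η₀ NS(X₀)_ℂ`). `⊇`: `p₃ = (X³ - 1)·q`. `⊆`: if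
`θv = 0` then `p₃(g)v = 0`, so `(27p₃ - p₃³)(g)v = 0`, i.e. `9(g⁶ + g³ - 2)v = 0`, and
`9(g³ - 1) = (g⁶ - 2g³ + 4)(g⁶ + g³ - 2)` modulo `g⁹ = 1`. Fact-free.
[cite: GeemenSchutt2023, §2.4 and §5.6] [cite: ArtebaniComparinValdes2020Order9, §1 and Example 3.5] -/
theorem ker_thetaC_eq_of_zeta9Model (hZ : Zeta9Model[g, y₀, θ]) :
    LinearMap.ker (thetaC θ) = LinearMap.ker (g ^ 3 - 1) := by
  have hg9 : g ^ 9 = 1 := hZ.2.2.1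
  have hθ := thetaC_eq_smul_aeval_of_zeta9Model hZ
  have hg31 : Polynomial.aeval g (X ^ 3 - 1 : ℂ[X]) = g ^ 3 - 1 := by
    rw [map_sub, map_pow, Polynomial.aeval_X, map_one]
  ext v
  simp only [LinearMap.mem_ker]
  constructor
  · intro hv
    -- `p₃(g) v = 0`
    set A : Module.End ℂ (K3Index → ℂ) := Polynomial.aeval g p₃ with hA
    have hAv : A v = 0 := by
      have h3 : (1 / 3 : ℂ) • A v = 0 := by
        have h := hv
        rw [hθ, LinearMap.smul_apply] at h
        exact h
      exact (smul_eq_zero.1 h3).resolve_left (by norm_num)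
    have hA3v : (A ^ 3) v = 0 := by
      rw [pow_succ, Module.End.mul_apply, hAv, map_zero]
    -- `(g⁶ + g³ - 2) v = 0`
    set B : Module.End ℂ (K3Index → ℂ) := Polynomial.aeval g (X ^ 6 + X ^ 3 - C (2 : ℂ) : ℂ[X]) with hB
    have hBv : B v = 0 := by
      have h := congrArg (Polynomial.aeval g) pThree_cubic_eq
      rw [aeval_mul_X_pow_nine_sub_one hg9, map_add, map_sub, map_mul, map_mul, map_pow,
        Polynomial.aeval_C, Polynomial.aeval_C, ← hA, ← hB] at h
      have h' := DFunLike.congr_fun h v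
      simp only [LinearMap.zero_apply, LinearMap.add_apply, LinearMap.sub_apply, Module.End.mul_apply,
        hAv, hA3v, map_zero, sub_zero, zero_add, Module.algebraMap_end_apply] at h'
      exact (smul_eq_zero.1 h').resolve_left (by norm_num)
    -- `9 (g³ - 1) v = 0`
    have h := congrArg (Polynomial.aeval g) nine_mul_X_cube_sub_one_eq
    rw [aeval_mul_X_pow_nine_sub_one hg9, map_sub, map_mul, map_mul, Polynomial.aeval_C, hg31, ← hB] at h
    have h' := DFunLike.congr_fun h v
    simp only [LinearMap.zero_apply, LinearMap.sub_apply, Module.End.mul_apply, hBv, map_zero, sub_zero,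
      Module.algebraMap_end_apply] at h'
    exact (smul_eq_zero.1 h').resolve_left (by norm_num)
  · intro hv
    rw [hθ, LinearMap.smul_apply, pThree_eq_mul, map_mul, Module.End.mul_apply, hg31, hv, map_zero,
      smul_zero]

/-- **`dim ker θ_ℂ = 10` for every ζ₉ datum**: a K3 surface whose admissible endomorphism `t`
(killing `N¹`) is conjugate to `θ_ℂ` has `ρ ≤ dim ker t = 10`, with equality when `t` is injective on
`T` (Zarhin) — the rational real-multiplication type `θ` lives at Picard number `10`, INSIDE the open
Picard list `{4, 6, 7, 8, 10, 12, 13, 14, 16}` of crux `PicardThreeK3Squares`. Fact-free.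
[cite: GeemenSchutt2023, Thm. 1.1 (9)] [cite: Huybrechts2016K3, Ch. 3 Cor. 3.6] -/
theorem finrank_ker_thetaC_of_zeta9Model (hZ : Zeta9Model[g, y₀, θ]) :
    Module.finrank ℂ (LinearMap.ker (thetaC θ)) = 10 := by
  rw [ker_thetaC_eq_of_zeta9Model hZ]
  exact hZ.2.2.2.1

end Summit.HodgeConjecture.HodgeConjecture.Theorems.MarkmanPartnerTransport.RMTypeOrbit

end
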